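import Summits.ValiantsHypothesis.ValiantsHypothesis.Theorems.LacunarySymmetroidMatrixDescartesOverlapWindow

/-!
# `MatrixDescartes` — the robust Descartes rule in COEFFICIENT currency (any real polynomial; rank-deficient letters)

HONEST FRAMING.  Object-search cell `pub-symmetroid`, crux `Theses.LacunarySymmetroid.MatrixDescartes` (ledger item
`stmt-ValiantsHypothesis-18050`, route `LacunarySymmetroid`; seat `val-sym-mdr-p2`, gen 13).  The crux implies `VP ≠ VNP`
by the route's assembly; NOTHING here is progress on it, and nothing here is a claim about `VP ≠ VNP`, `DoorA26` /
`DoorA34` or the cell's registers.  Sequel of `…RobustDescartes` / `…OverlapWindow`.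

WHY.  The overlap window law (`Overlap.card_roots_Icc_le_of_liveSet`) keeps the pure power `det S t·X^(m·d t)` of a letter of
extreme exponent; when the dominant letter is RANK-DEFICIENT (`det S t = 0`: the graft / flag mechanism of every census
extremal — a near-null END letter whose window carries the zeros of the null compression of the others) that survivor is
dead and the law is void, exactly as the letter-separated sector's conditioning `|det S l| ≥ η σ_l^m` fails there.  The
cure is to work with the TRUE COEFFICIENTS of `det F`: by the row-choice expansion the coefficient of `X^n` is
`C_n = ∑_{f : e f = n} det N_f` (`coeff_det_pencil`), cancellations inside a fibre included, and the robust Descartes rule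
holds verbatim for the coefficient representation of ANY real polynomial (`card_roots_Icc_le_coeff`, one survivor checked at
the two endpoints; `card_roots_Icc_le_coeff_two`, two same-sign survivors with a split point): choose real cuts `A`, a
surviving exponent `a` (resp. two, `a < a'`), and certify that the `∏|n − α|`-weighted absolute mass of the UNCUT,
NON-SURVIVING coefficients is below the weighted survivor(s) on the window.  RECIPE for a window dominated in norm by a
letter `t` of rank `ρ < m`: the live sub-determinant is `det(X^(d t) S t + lower letters)`, its extreme non-zero
coefficient sits at the mixed exponent `ρ·d t + (m−ρ)·d l'` (complementary minors), and one cuts the other exponents of the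
live sub-pencil — the count is again Descartes' for the live monomials, the flag's zeros included.  No matrices are needed
for §12; §13 records the pencil's coefficients.  [folklore] (Laguerre's method).
-/

-- `Summit.ValiantsHypothesis.ValiantsHypothesis.…` repeats a component by the D-0017 layout (single-conjunct summit).
set_option linter.dupNamespace false

namespace Summit.ValiantsHypothesis.ValiantsHypothesis.Theorems.LacunarySymmetroidMatrixDescartes.Overlap

open Polynomial Finset Set
open scoped BigOperators Matrix

variable {K m : ℕ}

/-! ## §12 Coefficient currency: any real polynomial -/

/-- **Robust Descartes rule, coefficient currency, one survivor.**  `P` any real polynomial, `A` real cuts, `a` a surviving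
exponent.  If at the two endpoints of `[u, v]` (`0 < u ≤ v`)
`∑_{n ∈ supp P, n ≠ a} |∏_{α∈A}(n − α)|·|coeff P n|·x^n < |∏_{α∈A}(a − α)|·|coeff P a|·x^a` (the cut coefficients, `(n : ℝ) ∈ A`,
contribute nothing), then `P` has at most `#A` distinct zeros in `[u, v]`. [folklore] -/
theorem card_roots_Icc_le_coeff (P : ℝ[X]) (A : Finset ℝ) (a : ℕ) {u v : ℝ} (hu : 0 < u) (huv : u ≤ v)
    (hdom : ∀ x : ℝ, (x = u ∨ x = v) →
      ∑ n ∈ P.support.filter (fun n => n ≠ a), |∏ α ∈ A, ((n : ℝ) - α)| * |P.coeff n| * x ^ n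
        < |∏ α ∈ A, ((a : ℝ) - α)| * |P.coeff a| * x ^ a) :
    (P.roots.toFinset.filter (fun x => x ∈ Icc u v)).card ≤ A.card := by
  classical
  conv_lhs => rw [P.as_sum_support_C_mul_X_pow]
  refine RobustDescartes.card_roots_Icc_le_of_survivor P.support P.coeff id A a hu huv ?_ ?_
  · have h := hdom u (Or.inl rfl)
    have hsurv : ∑ i ∈ P.support.filter (fun i => (id i) = a), P.coeff i * ∏ α ∈ A, (((id i : ℕ) : ℝ) - α)
        = P.coeff a * ∏ α ∈ A, ((a : ℝ) - α) := by
      by_cases ha : a ∈ P.support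
      · rw [Finset.sum_eq_single_of_mem a (by rw [Finset.mem_filter]; exact ⟨ha, rfl⟩)
          (fun n hn hne => by rw [Finset.mem_filter] at hn; exact absurd hn.2 hne)]
        rfl
      · have h0 : P.coeff a = 0 := by rwa [mem_support_iff, not_not] at ha
        rw [h0, zero_mul]
        refine Finset.sum_eq_zero fun n hn => ?_
        rw [Finset.mem_filter] at hn
        have : n = a := hn.2
        rw [this, h0, zero_mul]
    rw [hsurv, abs_mul, mul_comm |P.coeff a|]
    refine lt_of_le_of_lt (le_of_eq (Finset.sum_congr rfl fun n _ => ?_)) h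
    simp only [id, abs_mul]; ring
  · have h := hdom v (Or.inr rfl)
    have hsurv : ∑ i ∈ P.support.filter (fun i => (id i) = a), P.coeff i * ∏ α ∈ A, (((id i : ℕ) : ℝ) - α)
        = P.coeff a * ∏ α ∈ A, ((a : ℝ) - α) := by
      by_cases ha : a ∈ P.support
      · rw [Finset.sum_eq_single_of_mem a (by rw [Finset.mem_filter]; exact ⟨ha, rfl⟩)
          (fun n hn hne => by rw [Finset.mem_filter] at hn; exact absurd hn.2 hne)]
        rfl
      · have h0 : P.coeff a = 0 := by rwa [mem_support_iff, not_not] at ha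
        rw [h0, zero_mul]
        refine Finset.sum_eq_zero fun n hn => ?_
        rw [Finset.mem_filter] at hn
        have : n = a := hn.2
        rw [this, h0, zero_mul]
    rw [hsurv, abs_mul, mul_comm |P.coeff a|]
    refine lt_of_le_of_lt (le_of_eq (Finset.sum_congr rfl fun n _ => ?_)) h
    simp only [id, abs_mul]; ring

/-- **Robust Descartes rule, coefficient currency, two survivors.**  `P` any real polynomial, `A` real cuts, two surviving
exponents `a ≠ a'` whose cut coefficients `coeff P a·∏(a − α)` and `coeff P a'·∏(a' − α)` have a non-negative product
(parity; one extra cut strictly between `a` and `a'` flips it), a split point `u ≤ c ≤ v` (`0 < u`).  If the weighted absolute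
mass of the other coefficients is below the `a`-survivor at `x = u, c` and below the `a'`-survivor at `x = c, v`, then `P` has
at most `#A` distinct zeros in `[u, v]`. [folklore] -/
theorem card_roots_Icc_le_coeff_two (P : ℝ[X]) (A : Finset ℝ) (a a' : ℕ) (haa : a ≠ a')
    (hsign : 0 ≤ (P.coeff a * ∏ α ∈ A, ((a : ℝ) - α)) * (P.coeff a' * ∏ α ∈ A, ((a' : ℝ) - α)))
    {u c v : ℝ} (hu : 0 < u) (huc : u ≤ c) (hcv : c ≤ v)
    (hdom : ∀ x : ℝ, (x = u ∨ x = c) →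
      ∑ n ∈ P.support.filter (fun n => n ≠ a ∧ n ≠ a'), |∏ α ∈ A, ((n : ℝ) - α)| * |P.coeff n| * x ^ n
        < |∏ α ∈ A, ((a : ℝ) - α)| * |P.coeff a| * x ^ a)
    (hdom' : ∀ x : ℝ, (x = c ∨ x = v) →
      ∑ n ∈ P.support.filter (fun n => n ≠ a ∧ n ≠ a'), |∏ α ∈ A, ((n : ℝ) - α)| * |P.coeff n| * x ^ n
        < |∏ α ∈ A, ((a' : ℝ) - α)| * |P.coeff a'| * x ^ a') :
    (P.roots.toFinset.filter (fun x => x ∈ Icc u v)).card ≤ A.card := by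
  classical
  conv_lhs => rw [P.as_sum_support_C_mul_X_pow]
  refine RobustDescartes.card_roots_Icc_le_card_cuts P.support P.coeff id A hu (huc.trans hcv) fun x hx => ?_
  have hx0 : 0 ≤ x := hu.le.trans hx.1
  rw [RobustDescartes.eval_sum_C_mul_X_pow]
  simp only [id]
  rw [← Finset.sum_filter_add_sum_filter_not P.support (fun n => n ≠ a ∧ n ≠ a')]
  -- the two survivor terms
  set Ta : ℝ := P.coeff a * (∏ α ∈ A, ((a : ℝ) - α)) * x ^ a with hTa
  set Ta' : ℝ := P.coeff a' * (∏ α ∈ A, ((a' : ℝ) - α)) * x ^ a' with hTa'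
  have hsurv : ∑ n ∈ P.support.filter (fun n => ¬ (n ≠ a ∧ n ≠ a')),
      P.coeff n * (∏ α ∈ A, ((n : ℝ) - α)) * x ^ n = Ta + Ta' := by
    have hsub : P.support.filter (fun n => ¬ (n ≠ a ∧ n ≠ a')) ⊆ {a, a'} := by
      intro n hn
      rw [Finset.mem_filter] at hn
      rw [Finset.mem_insert, Finset.mem_singleton]
      by_contra hcon
      push Not at hcon
      exact hn.2 hcon
    rw [Finset.sum_subset hsub (fun n hn hnot => ?_), Finset.sum_pair haa]
    -- outside the support filter but in `{a, a'}`: the coefficient vanishes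
    have hns : n ∉ P.support := by
      intro hmem
      apply hnot
      rw [Finset.mem_filter]
      refine ⟨hmem, ?_⟩
      rw [Finset.mem_insert, Finset.mem_singleton] at hn
      push Not
      rcases hn with rfl | rfl
      · exact fun h => absurd rfl h
      · exact fun _ => rfl
    rw [mem_support_iff, not_not] at hns
    rw [hns, zero_mul, zero_mul]
  rw [hsurv]
  have hTT : 0 ≤ Ta * Ta' := by
    have : Ta * Ta' = ((P.coeff a * ∏ α ∈ A, ((a : ℝ) - α)) * (P.coeff a' * ∏ α ∈ A, ((a' : ℝ) - α))) *
        (x ^ a * x ^ a') := by rw [hTa, hTa']; ring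
    rw [this]; exact mul_nonneg hsign (mul_nonneg (pow_nonneg hx0 _) (pow_nonneg hx0 _))
  have habs : |Ta + Ta'| = |Ta| + |Ta'| := by
    rcases mul_nonneg_iff.1 hTT with ⟨h1, h2⟩ | ⟨h1, h2⟩
    · rw [abs_of_nonneg h1, abs_of_nonneg h2, abs_of_nonneg (add_nonneg h1 h2)]
    · rw [abs_of_nonpos h1, abs_of_nonpos h2, abs_of_nonpos (add_nonpos h1 h2), neg_add]
  have hTa_abs : |Ta| = |∏ α ∈ A, ((a : ℝ) - α)| * |P.coeff a| * x ^ a := by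
    rw [hTa, abs_mul, abs_mul, abs_of_nonneg (pow_nonneg hx0 _)]; ring
  have hTa'_abs : |Ta'| = |∏ α ∈ A, ((a' : ℝ) - α)| * |P.coeff a'| * x ^ a' := by
    rw [hTa', abs_mul, abs_mul, abs_of_nonneg (pow_nonneg hx0 _)]; ring
  have hwpos : ∀ n : ℕ, 0 ≤ |∏ α ∈ A, ((n : ℝ) - α)| * |P.coeff n| := fun n => mul_nonneg (abs_nonneg _) (abs_nonneg _)
  have htail : |∑ n ∈ P.support.filter (fun n => n ≠ a ∧ n ≠ a'), P.coeff n * (∏ α ∈ A, ((n : ℝ) - α)) * x ^ n|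
      ≤ ∑ n ∈ P.support.filter (fun n => n ≠ a ∧ n ≠ a'), |∏ α ∈ A, ((n : ℝ) - α)| * |P.coeff n| * x ^ n := by
    refine (Finset.abs_sum_le_sum_abs _ _).trans (le_of_eq (Finset.sum_congr rfl fun n _ => ?_))
    rw [abs_mul, abs_mul, abs_of_nonneg (pow_nonneg hx0 _)]; ring
  have hlt : ∑ n ∈ P.support.filter (fun n => n ≠ a ∧ n ≠ a'), |∏ α ∈ A, ((n : ℝ) - α)| * |P.coeff n| * x ^ n
      < |Ta| + |Ta'| := by
    rcases le_total x c with hxc | hcx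
    · have h := RobustDescartes.sum_mul_pow_lt_of_endpoints (P.support.filter (fun n => n ≠ a ∧ n ≠ a'))
        (fun n => |∏ α ∈ A, ((n : ℝ) - α)| * |P.coeff n|) (fun n _ => hwpos n) id a hu hx.1 hxc
        (hdom u (Or.inl rfl)) (hdom c (Or.inr rfl))
      rw [hTa_abs]
      simp only [id] at h
      linarith [abs_nonneg Ta']
    · have h := RobustDescartes.sum_mul_pow_lt_of_endpoints (P.support.filter (fun n => n ≠ a ∧ n ≠ a'))
        (fun n => |∏ α ∈ A, ((n : ℝ) - α)| * |P.coeff n|) (fun n _ => hwpos n) id a' (hu.trans_le huc) hcx hx.2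
        (hdom' c (Or.inl rfl)) (hdom' v (Or.inr rfl))
      rw [hTa'_abs]
      simp only [id] at h
      linarith [abs_nonneg Ta]
  intro h0
  have h1 : Ta + Ta' = -(∑ n ∈ P.support.filter (fun n => n ≠ a ∧ n ≠ a'),
      P.coeff n * (∏ α ∈ A, ((n : ℝ) - α)) * x ^ n) := by linarith
  have h2 : |Ta + Ta'| ≤ ∑ n ∈ P.support.filter (fun n => n ≠ a ∧ n ≠ a'),
      |∏ α ∈ A, ((n : ℝ) - α)| * |P.coeff n| * x ^ n := by rw [h1, abs_neg]; exact htail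
  rw [habs] at h2
  linarith

/-! ## §13 The coefficients of a lacunary pencil's determinant -/

/-- **Coefficients of the pencil determinant.**  The coefficient of `X^n` in `det (∑ₗ X^(d l) • S l)` is the fibre sum
`∑_{f : ∑ᵢ d (f i) = n} det N_f` of row-choice determinants — cancellations inside the fibre included (this is where a
rank-deficient dominant letter loses its pure power and the mixed exponents take over). [folklore] -/
theorem coeff_det_pencil (d : Fin K → ℕ) (S : Fin K → Matrix (Fin m) (Fin m) ℝ) (n : ℕ) :
    (Matrix.det (∑ l, ((X : ℝ[X]) ^ d l) • (S l).map C)).coeff n =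
      ∑ f ∈ Finset.univ.filter (fun f : Fin m → Fin K => (∑ i, d (f i)) = n),
        Matrix.det (Matrix.of fun i j => S (f i) i j) := by
  classical
  rw [det_pencil_eq_sum_C_mul_X_pow, finsetSum_coeff, Finset.sum_filter]
  refine Finset.sum_congr rfl fun f _ => ?_
  rw [coeff_C_mul_X_pow]
  by_cases h : (∑ i, d (f i)) = n
  · rw [if_pos h, if_pos h.symm]
  · rw [if_neg h, if_neg (fun h' => h h'.symm)]

/-- Absolute coefficient bound by the fibre's row-choice determinants. [folklore] -/
theorem abs_coeff_det_pencil_le (d : Fin K → ℕ) (S : Fin K → Matrix (Fin m) (Fin m) ℝ) (n : ℕ) :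
    |(Matrix.det (∑ l, ((X : ℝ[X]) ^ d l) • (S l).map C)).coeff n| ≤
      ∑ f ∈ Finset.univ.filter (fun f : Fin m → Fin K => (∑ i, d (f i)) = n),
        |Matrix.det (Matrix.of fun i j => S (f i) i j)| := by
  rw [coeff_det_pencil]
  exact Finset.abs_sum_le_sum_abs _ _

end Summit.ValiantsHypothesis.ValiantsHypothesis.Theorems.LacunarySymmetroidMatrixDescartes.Overlap
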